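import Literature.MathematicalPhysics.QuantumFieldTheory.Balaban1983to89.B9Thm311FlatHermKernelZd
import Literature.MathematicalPhysics.QuantumFieldTheory.Balaban1983to89.B9Eq327GreenZdHerm

/-!
# `Balaban1983to89.B9Thm311PosDefOpenZd` — [Balaban1985BackgroundPropagators] THEOREM 3.11 AT THE `ℤᵈ × 𝔸` CARRIER, STEP (ii) OF THE PER-MEMBER ROAD:
# «POSITIVE DEFINITE» IS OPEN IN THE BACKGROUND — if `0 < ⟨A, Δ_a(U₁)A⟩_τ` on a field class `E(Ω₀)` ∕ `E_𝔤(Ω₀)` (finite `Ω₀`) and the letters of `Δ_a(U₀)`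
# are ℝ-linear and CONTINUOUS IN `U₀` (within a background set `𝒰`, at `U₁`), then `0 < ⟨A, Δ_a(U₀)A⟩_τ` for all `U₀ ∈ 𝒰` near `U₁`; at every cube member of
# [Balaban1985RegularSpaces] (1.131) this turns dag-n06-b's flat base case (`flat_posDef_herm_cube`, `U₀ = 1`) into Theorem 3.11's positivity ∕ (3.27)'s
# invertibility for the genuine four-letter record `opsAllZd` on a NEIGHBOURHOOD OF THE FLAT BACKGROUND — modulo the displayed continuity of its letters,
# of which the first (`D*D`) is discharged here

statement-level skeleton of published theorems with citation tags; proofs where landed; nothing here is a claim about the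
Yang–Mills mass gap

`[Balaban1985BackgroundPropagators]` ("B9", CMP **99** (1985) 389–434) p. 416, Theorem 3.11: *«Under the assumptions of the Theorems 3.1–3.10 (i.e. for
M sufficiently large and α₀ sufficiently small) the operators Δ′_a, G′, (Q′G′²Q′*)⁻¹, Δ_a, G are positive definite.»*; p. 395 (3.26)–(3.27): *«Δ^η_a(U) =
Δ^η(U) + D^η_U R(U) D^{η*}_U + Q*(U)aQ(U), (3.26) … G(U) = G = (Δ_a↾Ω₀)⁻¹. (3.27)»*; pp. 394–395: *«We do not know yet if the operators in the above formula
are well defined. Assuming some regularity of the configuration U it can be easily shown that the operator Δ′_a is positive.»*; p. 396 (3.35) (the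
small-field class of backgrounds).  `[Balaban1984PropagatorsII]` ("[4]", CMP **96**) (2.11) p. 225 («G_□(1)» positive — the flat base case print's proof of
Theorem 3.11 starts from, p. 416).  PDF held: `paper:balaban1985-cmp99-background-propagators` pp. 394–396, 416 (re-read by this seat, 2026-08-28).

CITATION HEADER (lean-in-tree rule).  Cell `pub-ymgap` (YM Track A, HUMAN RULING D-0062 ∕ D-0149 width push), DAG node N06 = [B9], width seat
`pub-ymgap-dag-n06-w4` (g3); the PER-MEMBER ROAD to Theorem 3.11 for the genuine letters at the junction J-N06→N05 (dag-n06-w2 g2 IDEA-3.11 l.27655 as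
corrected by this seat's g2 WORD l.27755 and dag-n06-b g18): (i)_𝔤 positivity at the flat background on the Hermitian fields (dag-n06-b,
`B9Thm311FlatHermKernelZd.flat_posDef_herm_cube`, p604421), (ii) CONTINUITY IN THE BACKGROUND ⟹ positivity on a neighbourhood (THIS FILE: the engine, the
`D*D` letter, the cube corollaries modulo the other letters' continuity), (iii) gauge covariance + [Balaban1985Averaging] Prop. 6.  The Hermitian sub-carrier
`E_𝔤(Ω₀) = domSubH`, `HermPreservingAt`, `RegularAtH`, `gopZdH` are dag-n06-b's (`B9Eq327GreenZdHerm`, p604417); `E(Ω₀) = domSub`, `bondPair`, `LinearOnDomAt`,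
`opsLevelZero` are this seat's g2 (`B9Eq327GreenZd`, p595052); the four-letter record `opsAllZd` is `B9SupplySockB9P3ZdAllLettersZd` (p598911).

WHAT IS DECLARED ∕ PROVED (kernel, 0 sorry; one displayed `Prop` + theorems; no `instance`, no `notation`).
* §1 (pure linear algebra ∕ topology, `[folklore]`) `bilin_equivFun_symm_eq_sum`; ★★ `posDef_eventually_of_continuousWithinAt` — for a family of BILINEAR
  forms `q x` on a finite-dimensional real space whose entries `x ↦ q x v w` are continuous within `S` at `x₀`: `q x₀` positive definite ⟹ `q x` positive
  definite for all `x ∈ S` near `x₀` (compact unit sphere in coordinates: `q x₀ ≥ m > 0` there; the `n²` entries move by `< m∕(2(n+1)²)`).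
* §2 (carrier) ★ `LettersContinuousWithinAt η o Ω₀ W 𝒰 U₁` (displayed `Prop`: for `A ∈ W` and every bond of `Ω₀`, `U₀ ↦ (Δ_a(U₀)A)(b)` is continuous within
  `𝒰` at `U₁`; `.mono`, `.mono_set`); ★★★ `bondPair_pos_eventually` — `Ω₀` finite, `𝔸` finite-dimensional, `W ≤ E(Ω₀)`, `U₁ ∈ 𝒰`: `LinearOnDomAt` on `𝒰` +
  `LettersContinuousWithinAt … W 𝒰 U₁` + `0 < ⟨A, Δ_a(U₁)A⟩_τ` on `W∖0` ⟹ `∀ᶠ U₀ in 𝓝[𝒰] U₁, ∀ A ∈ W, A ≠ 0 → 0 < ⟨A, Δ_a(U₀)A⟩_τ`; the readings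
  `bondPair_pos_eventually_domSub` (`W = E(Ω₀)`) and ★★ `bondPair_pos_eventually_domSubH` (`W = E_𝔤(Ω₀)`, letters continuous on Hermitian inputs only).
* §3 (the `D*D` letter) `continuous_conjR`, `continuous_conjR_comp`, `continuous_covDerivFwd_of`, `continuous_covDeriv_of`, `continuous_plaqCovDeriv`,
  ★ `continuous_Jcur` — `U₀ ↦ (D^{η*}_{U₀}D^η_{U₀}A)(b)` is continuous at EVERY background; A6: `lettersContinuousWithinAt_opsLevelZero`,
  `bondPair_pos_eventually_opsLevelZero` (the one-level record meets every hypothesis of §2 — the hypothesis class is inhabited in the tree).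
* §5 (reading the conclusion in bond variables) `exists_pos_le_forall`, `exists_ball_subset_of_mem_nhds_units` (the unit group of a C⋆-algebra carries the
  norm topology, Mathlib `Units.isOpenEmbedding_val`), `exists_ball_subset_of_mem_nhds_dir`, ★★ `exists_finset_ball_of_eventually_nhdsWithin` («for all
  `U₀ ∈ 𝒰` near `U₁`» ⟹ ∃ FINITE `F ⊂ ℤᵈ`, `δ > 0`: every `U₀ ∈ 𝒰` with `‖U₀(y,μ) − U₁(y,μ)‖ < δ`, `y ∈ F`), ★ `exists_delta_of_eventually_nhdsWithin` (sup-norm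
  reading: every `U₀ ∈ 𝒰` uniformly `δ`-close to `U₁`).
* §4 (cube members) `cubeMember_Ω0_finite`; ★★★ `bondPair_pos_eventually_one_cube` — at every cube member (`cubeFam false`, `cubeLamS`, class `cubeLamBP`,
  `m ≤ k`, `d, L ≥ 2`, faithful Hermitian tracial `τ`, finite-dimensional nontrivial fibre), for any `𝒰 ∋ 1` on which `Δ_a(U₀)` of `opsAllZd` is ℝ-linear on
  `E(□₀)` with letters continuous within `𝒰` at `1` on `E_𝔤(□₀)`: `∀ᶠ U₀ in 𝓝[𝒰] 1`, `0 < ⟨A, Δ_a(U₀)A⟩_τ` for every Hermitian `0 ≠ A ∈ E(□₀)`;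
  ★★★ `regularAtH_eventually_one_cube` (+ `HermPreservingAt` on `𝒰` ⟹ `Δ_a(U₀)↾□₀` invertible on `E_𝔤(□₀)` for all `U₀ ∈ 𝒰` near `1`);
  ★★ `gopZdH_deltaAOf_eventually_one_cube` ((3.27) as (1.58) uses it: `G_𝔤(U₀)(Δ_a(U₀)A) = A` there).

HONEST SCOPE.  (i) This is STEP (ii) only: an openness ENGINE plus ONE letter's continuity (`D*D`).  The continuity of the other three genuine letters —
`Δ′(U₀)` ((3.10), polynomial in the bond variables), `Q*aQ(U₀)` (through the group-valued averages `Ū₀ʲ` = `bgT`, (42)–(43) of [Balaban1985Averaging], within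
(1.7)), `D R(U₀) 𝟙D*` (through (3.25) and the continuity of inverses of positive operators) — is NOT proved here; it is the displayed hypothesis
`LettersContinuousWithinAt … (opsAllZd …) …` of §4, to be discharged letter by letter by this seat's successor files.  (ii) Even then the outcome is Theorem 3.11
at each cube member on a MEMBER-DEPENDENT neighbourhood of the flat background (no uniform `α₀′`, no estimate (3.115), no `M₀`); print's uniformity is the
content of Sects. B–E.  (iii) «Near `U₁`» is the product topology on `ℤᵈ × {directions} → 𝔸ˣ`; §5 reads it as «finitely many bond variables `δ`-close», which
every uniformly-small class implies.  (iv) `τ` is a PARAMETER with displayed properties; no instance.  (v) Count-neutral; N05 ∕ N06 NOT discharged; K1⁷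
`stmt-QuantumFields-20542` NOT closed; one finite `𝕋⁴` programme at fixed `ε`, Bałaban as printed; R4 closes only the conditional finite-`𝕋⁴` rung
`BalabanLadder.UV` — nothing continuum ∕ ℝ⁴ ∕ OS ∕ mass gap ∕ Clay.  Unit `pub-ymgap-dag-n06-w4` (g3), 2026-08-28.
-/

noncomputable section

namespace Literature.MathematicalPhysics.QuantumFieldTheory.Balaban1983to89.B9Thm311PosDefOpenZd

open Filter Topology

/-! ## §1  Linear algebra: positive-definiteness of a continuously-parametrised bilinear form on a finite-dimensional real space is open -/

section Abstract

variable {X : Type*} [TopologicalSpace X] {V : Type*} [AddCommGroup V] [Module ℝ V] [FiniteDimensional ℝ V]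

omit [FiniteDimensional ℝ V] in
/-- coordinates: a bilinear form on the vector with coordinates `c` in a basis `b` is the double sum of its entries. [folklore] -/
private theorem bilin_equivFun_symm_eq_sum {n : ℕ} (b : Module.Basis (Fin n) ℝ V) (B : V →ₗ[ℝ] V →ₗ[ℝ] ℝ) (c c' : Fin n → ℝ) :
    B (b.equivFun.symm c) (b.equivFun.symm c') = ∑ i, ∑ j, c i * c' j * B (b i) (b j) := by
  simp only [Module.Basis.equivFun_symm_apply, map_sum, map_smul, LinearMap.sum_apply, LinearMap.smul_apply, smul_eq_mul,
    Finset.mul_sum]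
  rw [Finset.sum_comm]
  refine Finset.sum_congr rfl fun i _ => Finset.sum_congr rfl fun j _ => ?_
  ring

/-- ★★ **POSITIVE-DEFINITENESS IS AN OPEN CONDITION** for a family of bilinear forms on a finite-dimensional real space whose ENTRIES are
continuous (within a set `S`, at a point `x₀`): if `q x₀` is positive definite then so is `q x` for all `x ∈ S` near `x₀`.  (Compactness of the
unit sphere in coordinates: `q x₀ ≥ m > 0` there; the `n²` entries move by `< m ∕ (2(n+1)²)` near `x₀`.)  The linear-algebra mechanism behind
«positive definite … for U satisfying (3.35)» read background by background.
[cite: Balaban1985BackgroundPropagators, Thm 3.11 p.416 (bookkeeping: the finite-dimensional openness mechanism, not a printed statement)] -/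
theorem posDef_eventually_of_continuousWithinAt (q : X → V →ₗ[ℝ] V →ₗ[ℝ] ℝ) (S : Set X) (x₀ : X)
    (hcont : ∀ v w : V, ContinuousWithinAt (fun x => q x v w) S x₀) (hpos : ∀ v : V, v ≠ 0 → 0 < q x₀ v v) :
    ∀ᶠ x in 𝓝[S] x₀, ∀ v : V, v ≠ 0 → 0 < q x v v := by
  classical
  set n : ℕ := Module.finrank ℝ V with hn
  let b : Module.Basis (Fin n) ℝ V := Module.finBasis ℝ V
  -- the unit sphere of the coordinate space (sup norm) is compact
  set K : Set (Fin n → ℝ) := Metric.sphere (0 : Fin n → ℝ) 1 with hK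
  have hKc : IsCompact K := isCompact_sphere (0 : Fin n → ℝ) 1
  -- `q x₀` in coordinates is continuous and positive on the sphere
  have hf : ContinuousOn (fun c : Fin n → ℝ => ∑ i, ∑ j, c i * c j * q x₀ (b i) (b j)) K := by
    refine Continuous.continuousOn ?_
    refine continuous_finsetSum _ fun i _ => continuous_finsetSum _ fun j _ => ?_
    exact ((continuous_apply i).mul (continuous_apply j)).mul continuous_const
  have hf' : ∀ c ∈ K, (0 : ℝ) < ∑ i, ∑ j, c i * c j * q x₀ (b i) (b j) := by
    intro c hc
    rw [← bilin_equivFun_symm_eq_sum b (q x₀) c c]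
    refine hpos _ fun h0 => ?_
    have hc0 : c = 0 := by
      have := congrArg b.equivFun h0
      rwa [LinearEquiv.apply_symm_apply, map_zero] at this
    rw [hK, mem_sphere_zero_iff_norm, hc0, norm_zero] at hc
    exact zero_ne_one hc
  obtain ⟨m, hm0, hm⟩ := hKc.exists_forall_le' hf hf'
  -- the entries are eventually within `ε = m ∕ (2(n+1)²)` of their values at `x₀`
  set ε : ℝ := m / (2 * ((n : ℝ) + 1) ^ 2) with hε
  have hεpos : 0 < ε := by positivity
  have hev : ∀ᶠ x in 𝓝[S] x₀, ∀ i j : Fin n, dist (q x (b i) (b j)) (q x₀ (b i) (b j)) < ε := by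
    refine eventually_all.2 fun i => eventually_all.2 fun j => ?_
    exact Metric.tendsto_nhds.1 (hcont (b i) (b j)) ε hεpos
  filter_upwards [hev] with x hx
  intro v hv
  -- coordinates of `v`, normalised to the sphere
  set c : Fin n → ℝ := b.equivFun v with hcdef
  have hvc : v = b.equivFun.symm c := by rw [hcdef, LinearEquiv.symm_apply_apply]
  have hc0 : c ≠ 0 := by
    intro h0
    exact hv (by rw [hvc, h0, map_zero])
  set r : ℝ := ‖c‖ with hr
  have hrpos : 0 < r := norm_pos_iff.2 hc0
  set c' : Fin n → ℝ := r⁻¹ • c with hc'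
  have hc'K : c' ∈ K := by
    rw [hK, mem_sphere_zero_iff_norm, hc', norm_smul, norm_inv, Real.norm_of_nonneg hrpos.le, inv_mul_cancel₀ hrpos.ne']
  have hcc' : c = r • c' := by rw [hc', smul_smul, mul_inv_cancel₀ hrpos.ne', one_smul]
  -- `q x v v = r² · Q_x(c')`
  have hq : q x v v = r ^ 2 * ∑ i, ∑ j, c' i * c' j * q x (b i) (b j) := by
    rw [hvc, bilin_equivFun_symm_eq_sum b (q x) c c, hcc', Finset.mul_sum]
    refine Finset.sum_congr rfl fun i _ => ?_
    rw [Finset.mul_sum]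
    refine Finset.sum_congr rfl fun j _ => ?_
    simp only [Pi.smul_apply, smul_eq_mul]
    ring
  rw [hq]
  refine mul_pos (pow_pos hrpos 2) ?_
  -- `Q_x(c') ≥ Q_{x₀}(c') − n²ε ≥ m − m∕2 > 0`
  have hcoord : ∀ i, |c' i| ≤ 1 := by
    intro i
    have h1 : ‖c' i‖ ≤ ‖c'‖ := norm_le_pi_norm c' i
    rw [mem_sphere_zero_iff_norm.1 hc'K] at h1
    exact h1
  have hterm : ∀ i j, c' i * c' j * q x₀ (b i) (b j) - ε ≤ c' i * c' j * q x (b i) (b j) := by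
    intro i j
    have hd : |q x (b i) (b j) - q x₀ (b i) (b j)| < ε := by
      have := hx i j
      rwa [Real.dist_eq] at this
    have hprod : |c' i * c' j| ≤ 1 := by
      rw [abs_mul]
      exact mul_le_one₀ (hcoord i) (abs_nonneg _) (hcoord j)
    have key : |c' i * c' j * (q x (b i) (b j) - q x₀ (b i) (b j))| ≤ ε := by
      rw [abs_mul]
      calc |c' i * c' j| * |q x (b i) (b j) - q x₀ (b i) (b j)| ≤ 1 * ε :=
            mul_le_mul hprod hd.le (abs_nonneg _) zero_le_one
        _ = ε := one_mul ε
    have := neg_abs_le (c' i * c' j * (q x (b i) (b j) - q x₀ (b i) (b j)))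
    nlinarith [key, this]
  have hsum : (∑ i, ∑ j, c' i * c' j * q x₀ (b i) (b j)) - (n : ℝ) ^ 2 * ε ≤ ∑ i, ∑ j, c' i * c' j * q x (b i) (b j) := by
    have h1 : ∑ i : Fin n, ∑ j : Fin n, (c' i * c' j * q x₀ (b i) (b j) - ε) ≤ ∑ i, ∑ j, c' i * c' j * q x (b i) (b j) :=
      Finset.sum_le_sum fun i _ => Finset.sum_le_sum fun j _ => hterm i j
    have h2 : ∑ i : Fin n, ∑ j : Fin n, (c' i * c' j * q x₀ (b i) (b j) - ε) =
        (∑ i, ∑ j, c' i * c' j * q x₀ (b i) (b j)) - (n : ℝ) ^ 2 * ε := by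
      simp only [Finset.sum_sub_distrib, Finset.sum_const, Finset.card_univ, Fintype.card_fin]
      ring
    rw [← h2]
    exact h1
  have hmK := hm c' hc'K
  have hnε : (n : ℝ) ^ 2 * ε ≤ m / 2 := by
    rw [hε]
    have hn1 : (0 : ℝ) < ((n : ℝ) + 1) ^ 2 := by positivity
    rw [show (n : ℝ) ^ 2 * (m / (2 * ((n : ℝ) + 1) ^ 2)) = (m / 2) * ((n : ℝ) ^ 2 / ((n : ℝ) + 1) ^ 2) by
      field_simp]
    refine mul_le_of_le_one_right (by positivity) ?_
    rw [div_le_one hn1]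
    nlinarith [Nat.cast_nonneg (α := ℝ) n]
  linarith

end Abstract

/-! ## §2  The carrier: continuity of `Δ_a(U₀)`'s letters in the background ⟹ positivity of `⟨A, Δ_a(U₀)A⟩_τ` is open in `U₀` -/

section Carrier

open B7Prop1Explicit
open B8Ineq132 (BondTouches)
open B9SupplySockB9P3ZdLetters (OpsZd deltaAOf)
open B9Eq327GreenZd (domSub bondPair LinearOnDomAt setOf_bondTouches_finite finiteDimensional_domSub)
open B9Eq327GreenZdHerm (domSubH domSubH_le mem_domSubH_iff)
open B9Eq316AveragingTransposeZd (tauForm tauForm_apply)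
open B9Thm311FlatHermKernelZd (bondPair_eq_sum_of_vanish_off)

-- `Site` alone could resolve to the torus sites of `Setup.lean`; re-export the `ℤ^d` sites of `B7Prop1Explicit`.
export B7Prop1Explicit (Site)

variable {d : ℕ} {𝔸 : Type*} [CStarAlgebra 𝔸]

/-- ★ **«THE LETTERS OF `Δ_a(U₀)` ARE CONTINUOUS IN THE BACKGROUND»** — within a set `𝒰` of backgrounds, at `U₁`, on the fields of `W`, read at the
bonds of `Ω₀`: for every `A ∈ W` and every bond `⟨y, y + e_μ⟩` with an end-point in `Ω₀`, `U₀ ↦ (Δ_a(U₀)A)(y, μ)` is continuous within `𝒰` at `U₁`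
(product topology on `U₀ : ℤᵈ × {directions} → 𝔸ˣ`).  A displayed `Prop` on the record's letters; for print's operators it holds in the regime (1.7)
(each letter is built from finitely many bond variables, their group-valued averages (42)–(43) of [Balaban1985Averaging], and inverses of
positive operators).  [cite: Balaban1985BackgroundPropagators, (3.26) p.395, (3.10) p.392, (3.16) p.393, (3.20)–(3.25) p.394] -/
def LettersContinuousWithinAt (η : ℝ) (o : OpsZd d 𝔸) (Ω₀ : Set (Site d)) (W : Submodule ℝ (Site d → Fin d → 𝔸))
    (𝒰 : Set (Site d → Fin d → 𝔸ˣ)) (U₁ : Site d → Fin d → 𝔸ˣ) : Prop :=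
  ∀ A ∈ W, ∀ (y : Site d) (μ : Fin d), BondTouches Ω₀ y μ → ContinuousWithinAt (fun U₀ => deltaAOf η o U₀ A y μ) 𝒰 U₁

/-- monotonicity in the field class. [cite: Balaban1985BackgroundPropagators, (3.26) p.395 (bookkeeping)] -/
theorem LettersContinuousWithinAt.mono {η : ℝ} {o : OpsZd d 𝔸} {Ω₀ : Set (Site d)} {W W' : Submodule ℝ (Site d → Fin d → 𝔸)}
    {𝒰 : Set (Site d → Fin d → 𝔸ˣ)} {U₁ : Site d → Fin d → 𝔸ˣ} (h : LettersContinuousWithinAt η o Ω₀ W 𝒰 U₁) (hW : W' ≤ W) :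
    LettersContinuousWithinAt η o Ω₀ W' 𝒰 U₁ :=
  fun A hA y μ hb => h A (hW hA) y μ hb

/-- monotonicity in the background set. [cite: Balaban1985BackgroundPropagators, (3.26) p.395 (bookkeeping)] -/
theorem LettersContinuousWithinAt.mono_set {η : ℝ} {o : OpsZd d 𝔸} {Ω₀ : Set (Site d)} {W : Submodule ℝ (Site d → Fin d → 𝔸)}
    {𝒰 𝒰' : Set (Site d → Fin d → 𝔸ˣ)} {U₁ : Site d → Fin d → 𝔸ˣ} (h : LettersContinuousWithinAt η o Ω₀ W 𝒰 U₁) (h𝒰 : 𝒰' ⊆ 𝒰) :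
    LettersContinuousWithinAt η o Ω₀ W 𝒰' U₁ :=
  fun A hA y μ hb => (h A hA y μ hb).mono h𝒰

/-- a field of `E(Ω₀)` vanishes off the finite bond set of a finite `Ω₀`. [cite: Balaban1985RegularSpaces, p.77 (bond convention)] -/
theorem eq_zero_of_not_mem_bondFinset {Ω₀ : Set (Site d)} (hΩ : Ω₀.Finite) {A : Site d → Fin d → 𝔸} (hA : A ∈ domSub (𝔸 := 𝔸) Ω₀)
    (b : Site d × Fin d) (hb : b ∉ (setOf_bondTouches_finite (d := d) hΩ).toFinset) : A b.1 b.2 = 0 := by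
  apply hA b.1 b.2
  intro h
  exact hb ((Set.Finite.mem_toFinset _).2 h)

/-- the fibre functional `Y ↦ Re τ(a* Y)` is continuous on a finite-dimensional fibre. [cite: Balaban1985BackgroundPropagators, p.391 («X·Y = tr XY»)] -/
theorem continuous_tauForm_right [FiniteDimensional ℝ 𝔸] (τ : 𝔸 →ₗ[ℂ] ℂ) (a : 𝔸) : Continuous fun Y : 𝔸 => tauForm τ a Y :=
  (tauForm τ a).continuous_of_finiteDimensional

/-- ★★★ **POSITIVITY OF `⟨A, Δ_a(U₀)A⟩_τ` ON A FIELD CLASS IS OPEN IN THE BACKGROUND** (finite `Ω₀`, finite-dimensional fibre).  Let `W ⊆ E(Ω₀)` be a real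
subspace of bond fields (e.g. `E(Ω₀)` itself, or the Hermitian fields `E_𝔤(Ω₀)`), `𝒰` a set of backgrounds containing `U₁`.  If `Δ_a(U₀)` is (the
restriction of) an ℝ-linear map on `E(Ω₀)` for every `U₀ ∈ 𝒰`, its letters are continuous in `U₀` within `𝒰` at `U₁` on `W`, and `0 < ⟨A, Δ_a(U₁)A⟩_τ` for
every `0 ≠ A ∈ W`, then `0 < ⟨A, Δ_a(U₀)A⟩_τ` for every `0 ≠ A ∈ W` and ALL `U₀ ∈ 𝒰` NEAR `U₁` — Theorem 3.11's «positive definite» propagates from one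
background to a neighbourhood.  (§1 applied to the bilinear forms `(A, B) ↦ Σ_{b} Re τ(A(b)* (Δ_a(U₀)B)(b))` on `W`.)
[cite: Balaban1985BackgroundPropagators, Thm 3.11 p.416 («the operators Δ′_a, G′, (Q′G′²Q′*)⁻¹, Δ_a, G are positive definite»), (3.26) p.395] -/
theorem bondPair_pos_eventually [FiniteDimensional ℝ 𝔸] (τ : 𝔸 →ₗ[ℂ] ℂ) {η : ℝ} {o : OpsZd d 𝔸} {Ω₀ : Set (Site d)} (hΩ : Ω₀.Finite)
    {W : Submodule ℝ (Site d → Fin d → 𝔸)} (hW : W ≤ domSub (𝔸 := 𝔸) Ω₀)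
    {𝒰 : Set (Site d → Fin d → 𝔸ˣ)} {U₁ : Site d → Fin d → 𝔸ˣ} (hU₁ : U₁ ∈ 𝒰)
    (hlin : ∀ U₀ ∈ 𝒰, LinearOnDomAt η o Ω₀ U₀) (hcont : LettersContinuousWithinAt η o Ω₀ W 𝒰 U₁)
    (hpos : ∀ A ∈ W, A ≠ 0 → 0 < bondPair τ A (deltaAOf η o U₁ A)) :
    ∀ᶠ U₀ in 𝓝[𝒰] U₁, ∀ A ∈ W, A ≠ 0 → 0 < bondPair τ A (deltaAOf η o U₀ A) := by
  classical
  haveI : FiniteDimensional ℝ (domSub (𝔸 := 𝔸) Ω₀) := finiteDimensional_domSub hΩ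
  haveI : FiniteDimensional ℝ W := Submodule.finiteDimensional_of_le hW
  choose! T hT using hlin
  let S : Finset (Site d × Fin d) := (setOf_bondTouches_finite (d := d) hΩ).toFinset
  have hS : ∀ A ∈ W, ∀ b : Site d × Fin d, b ∉ S → A b.1 b.2 = 0 :=
    fun A hA b hb => eq_zero_of_not_mem_bondFinset hΩ (hW hA) b hb
  have hSb : ∀ b ∈ S, BondTouches Ω₀ b.1 b.2 := fun b hb => (setOf_bondTouches_finite (d := d) hΩ).mem_toFinset.1 hb
  -- evaluation at a bond, as a linear map
  let ev : Site d × Fin d → ((Site d → Fin d → 𝔸) →ₗ[ℝ] 𝔸) := fun b =>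
    (LinearMap.proj (R := ℝ) (φ := fun _ : Fin d => 𝔸) b.2).comp (LinearMap.proj (R := ℝ) (φ := fun _ : Site d => Fin d → 𝔸) b.1)
  -- the bilinear forms `q U₀ (A, B) = Σ_{b ∈ S} Re τ(A(b)* (T U₀ B)(b))` on `W`
  let q : (Site d → Fin d → 𝔸ˣ) → W →ₗ[ℝ] W →ₗ[ℝ] ℝ := fun U =>
    ∑ b ∈ S, (tauForm τ).compl₁₂ ((ev b).comp W.subtype) ((ev b).comp ((T U).comp W.subtype))
  have hq : ∀ U (A B : W), q U A B = ∑ b ∈ S, tauForm τ ((A : Site d → Fin d → 𝔸) b.1 b.2) (T U B b.1 b.2) := by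
    intro U A B
    simp only [q, LinearMap.sum_apply, LinearMap.compl₁₂_apply, LinearMap.comp_apply, Submodule.subtype_apply, ev,
      LinearMap.proj_apply]
  -- on `𝒰` the diagonal is the pairing
  have hdiag : ∀ U ∈ 𝒰, ∀ A : W, q U A A = bondPair τ (A : Site d → Fin d → 𝔸) (deltaAOf η o U A) := by
    intro U hU A
    rw [hq, bondPair_eq_sum_of_vanish_off τ S (hS A A.2)]
    refine Finset.sum_congr rfl fun b _ => ?_
    rw [hT U hU A (hW A.2)]
  -- the entries are continuous within `𝒰` at `U₁`
  have hcq : ∀ A B : W, ContinuousWithinAt (fun U => q U A B) 𝒰 U₁ := by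
    intro A B
    have h : ContinuousWithinAt
        (fun U => ∑ b ∈ S, tauForm τ ((A : Site d → Fin d → 𝔸) b.1 b.2) (deltaAOf η o U B b.1 b.2)) 𝒰 U₁ := by
      refine tendsto_finsetSum S fun b hb => ?_
      exact ((continuous_tauForm_right τ ((A : Site d → Fin d → 𝔸) b.1 b.2)).tendsto _).comp (hcont B B.2 b.1 b.2 (hSb b hb))
    refine h.congr (fun U hU => ?_) ?_
    · rw [hq]
      exact Finset.sum_congr rfl fun b _ => by rw [hT U hU B (hW B.2)]
    · rw [hq]
      exact Finset.sum_congr rfl fun b _ => by rw [hT U₁ hU₁ B (hW B.2)]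
  -- positivity at `U₁`
  have hposq : ∀ A : W, A ≠ 0 → 0 < q U₁ A A := by
    intro A hA
    rw [hdiag U₁ hU₁ A]
    exact hpos A A.2 fun h => hA (Subtype.ext h)
  have hev := posDef_eventually_of_continuousWithinAt q 𝒰 U₁ hcq hposq
  filter_upwards [hev, eventually_mem_nhdsWithin] with U hU hU𝒰
  intro A hA hA0
  have h := hU ⟨A, hA⟩ fun h => hA0 (congrArg Subtype.val h)
  rwa [hdiag U hU𝒰] at h

/-- ★★ **THE `E(Ω₀)` READING**: positivity of `⟨A, Δ_a(U₀)A⟩_τ` on `E(Ω₀)∖0` is open in the background. [cite: Balaban1985BackgroundPropagators, Thm 3.11 p.416, (3.26)–(3.27) p.395] -/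
theorem bondPair_pos_eventually_domSub [FiniteDimensional ℝ 𝔸] (τ : 𝔸 →ₗ[ℂ] ℂ) {η : ℝ} {o : OpsZd d 𝔸} {Ω₀ : Set (Site d)} (hΩ : Ω₀.Finite)
    {𝒰 : Set (Site d → Fin d → 𝔸ˣ)} {U₁ : Site d → Fin d → 𝔸ˣ} (hU₁ : U₁ ∈ 𝒰)
    (hlin : ∀ U₀ ∈ 𝒰, LinearOnDomAt η o Ω₀ U₀) (hcont : LettersContinuousWithinAt η o Ω₀ (domSub Ω₀) 𝒰 U₁)
    (hpos : ∀ A ∈ domSub (𝔸 := 𝔸) Ω₀, A ≠ 0 → 0 < bondPair τ A (deltaAOf η o U₁ A)) :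
    ∀ᶠ U₀ in 𝓝[𝒰] U₁, ∀ A ∈ domSub (𝔸 := 𝔸) Ω₀, A ≠ 0 → 0 < bondPair τ A (deltaAOf η o U₀ A) :=
  bondPair_pos_eventually τ hΩ le_rfl hU₁ hlin hcont hpos

/-- ★★ **THE `E_𝔤(Ω₀)` READING** (Hermitian fields, the currency of `B9Eq327GreenZdHerm.PosDefInClassAtH`): positivity of `⟨A, Δ_a(U₀)A⟩_τ` on
`E_𝔤(Ω₀)∖0` is open in the background; the letters need only be continuous on HERMITIAN inputs. [cite: Balaban1985BackgroundPropagators, Thm 3.11 p.416, p.391 («hermitian»)] -/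
theorem bondPair_pos_eventually_domSubH [FiniteDimensional ℝ 𝔸] (τ : 𝔸 →ₗ[ℂ] ℂ) {η : ℝ} {o : OpsZd d 𝔸} {Ω₀ : Set (Site d)} (hΩ : Ω₀.Finite)
    {𝒰 : Set (Site d → Fin d → 𝔸ˣ)} {U₁ : Site d → Fin d → 𝔸ˣ} (hU₁ : U₁ ∈ 𝒰)
    (hlin : ∀ U₀ ∈ 𝒰, LinearOnDomAt η o Ω₀ U₀) (hcont : LettersContinuousWithinAt η o Ω₀ (domSubH Ω₀) 𝒰 U₁)
    (hpos : ∀ A ∈ domSubH (𝔸 := 𝔸) Ω₀, A ≠ 0 → 0 < bondPair τ A (deltaAOf η o U₁ A)) :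
    ∀ᶠ U₀ in 𝓝[𝒰] U₁, ∀ A ∈ domSubH (𝔸 := 𝔸) Ω₀, A ≠ 0 → 0 < bondPair τ A (deltaAOf η o U₀ A) :=
  bondPair_pos_eventually τ hΩ (domSubH_le Ω₀) hU₁ hlin hcont hpos

end Carrier

/-! ## §3  The `D*D` letter (B8's current `J = D^{η*}_{U₀}D^η_{U₀}A`) is continuous in the background, everywhere -/

section Current

open B7Prop1Explicit
open B7Eq78Linearization (conjR)
open B8Ineq132 (covDerivFwd covDeriv)
open B8Eq143PlaqExpansion (pdiv)
open B8Eq146AExpansion (plaqCovDeriv plaqCovDeriv_eq_covDerivFwd)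
open B8Eq155JBound (Jcur)

variable {d : ℕ} {𝔸 : Type*} [CStarAlgebra 𝔸]

/-- `R(X)Y = XYX⁻¹` is jointly continuous in the bond variable `X` and the fibre element `Y`. [cite: Balaban1985RegularSpaces, (1.1) p.76 («R(U(x, x′))»)] -/
theorem continuous_conjR : Continuous fun p : 𝔸ˣ × 𝔸 => conjR p.1 p.2 := by
  unfold conjR
  fun_prop

/-- `R(X)Y` along continuous arguments. [cite: Balaban1985RegularSpaces, (1.1) p.76 (bookkeeping)] -/
theorem continuous_conjR_comp {Z : Type*} [TopologicalSpace Z] {f : Z → 𝔸ˣ} {g : Z → 𝔸} (hf : Continuous f) (hg : Continuous g) :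
    Continuous fun z => conjR (f z) (g z) :=
  continuous_conjR.comp (hf.prodMk hg)

/-- **THE FORWARD COVARIANT DERIVATIVE (1.1) IS CONTINUOUS IN THE BACKGROUND** (jointly with a background-dependent argument function, read at
the two sites it uses). [cite: Balaban1985RegularSpaces, (1.1) p.76] -/
theorem continuous_covDerivFwd_of {Z : Type*} [TopologicalSpace Z] {V : Z → Site d → Fin d → 𝔸ˣ} (hV : Continuous V)
    {F : Z → Site d → 𝔸} (η : ℝ) (μ : Fin d) (x : Site d) (hF₁ : Continuous fun z => F z (x + e μ)) (hF₀ : Continuous fun z => F z x) :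
    Continuous fun z => covDerivFwd η (V z) μ (F z) x := by
  unfold covDerivFwd
  have h1 : Continuous fun z => V z x μ := (continuous_apply μ).comp ((continuous_apply x).comp hV)
  exact ((continuous_conjR_comp h1 hF₁).sub hF₀).const_smul _

/-- **THE BACKWARD COVARIANT DERIVATIVE (1.1) IS CONTINUOUS IN THE BACKGROUND.** [cite: Balaban1985RegularSpaces, (1.1) p.76] -/
theorem continuous_covDeriv_of {Z : Type*} [TopologicalSpace Z] {V : Z → Site d → Fin d → 𝔸ˣ} (hV : Continuous V)
    {F : Z → Site d → 𝔸} (η : ℝ) (ν : Fin d) (x : Site d) (hF₁ : Continuous fun z => F z (x - e ν)) (hF₀ : Continuous fun z => F z x) :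
    Continuous fun z => covDeriv η (V z) ν (F z) x := by
  unfold covDeriv
  have h1 : Continuous fun z => (V z (x - e ν) ν)⁻¹ := ((continuous_apply ν).comp ((continuous_apply (x - e ν)).comp hV)).inv
  exact ((continuous_conjR_comp h1 hF₁).sub hF₀).const_smul _

/-- **THE PLAQUETTE COVARIANT DERIVATIVE (3.4) IS CONTINUOUS IN THE BACKGROUND** (fixed bond field). [cite: Balaban1985BackgroundPropagators, (3.4) p.391] -/
theorem continuous_plaqCovDeriv (η : ℝ) (A : Site d → Fin d → 𝔸) (μ ν : Fin d) (x : Site d) :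
    Continuous fun U₀ : Site d → Fin d → 𝔸ˣ => plaqCovDeriv η U₀ A μ ν x := by
  have h : Continuous fun U₀ : Site d → Fin d → 𝔸ˣ =>
      covDerivFwd η U₀ μ (fun y => A y ν) x - covDerivFwd η U₀ ν (fun y => A y μ) x :=
    (continuous_covDerivFwd_of (Z := Site d → Fin d → 𝔸ˣ) (F := fun _ y => A y ν) continuous_id η μ x continuous_const
        continuous_const).sub
      (continuous_covDerivFwd_of (Z := Site d → Fin d → 𝔸ˣ) (F := fun _ y => A y μ) continuous_id η ν x continuous_const
        continuous_const)
  exact h.congr fun U₀ => (plaqCovDeriv_eq_covDerivFwd η U₀ A μ ν x).symm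

/-- ★ **THE `D*D` LETTER IS CONTINUOUS IN THE BACKGROUND, AT EVERY BACKGROUND**: for every bond field `A` and every bond, `U₀ ↦ (D^{η*}_{U₀}D^η_{U₀}A)(b)`
is continuous on `ℤᵈ × {directions} → 𝔸ˣ` (a finite combination of conjugations by bond variables). [cite: Balaban1985RegularSpaces, (1.55) p.86, (1.1)–(1.2) p.76; Balaban1985BackgroundPropagators, (3.10) p.392] -/
theorem continuous_Jcur (η : ℝ) (A : Site d → Fin d → 𝔸) (μ : Fin d) (x : Site d) :
    Continuous fun U₀ : Site d → Fin d → 𝔸ˣ => Jcur η U₀ A μ x := by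
  unfold Jcur pdiv
  refine (continuous_finsetSum _ fun ν _ => ?_).sub (continuous_finsetSum _ fun ν _ => ?_)
  · exact continuous_covDeriv_of continuous_id η ν x (continuous_plaqCovDeriv η A ν μ _) (continuous_plaqCovDeriv η A ν μ _)
  · exact continuous_covDeriv_of continuous_id η ν x (continuous_plaqCovDeriv η A μ ν _) (continuous_plaqCovDeriv η A μ ν _)

/-- **A6 ∕ NON-VACUITY — THE ONE-LEVEL RECORD's LETTERS ARE CONTINUOUS IN THE BACKGROUND EVERYWHERE** (`Δ_a(U₀)A = D*_{U₀}D_{U₀}A + η⁻²𝟙_{Ω₀}A`):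
`LettersContinuousWithinAt` holds for `B9Eq327GreenZd.opsLevelZero` on every field class, every background set, at every background — so the hypotheses of
§2 (with `linearOnDomAt_opsLevelZero`, `bondPair_deltaAOf_opsLevelZero_pos`) are inhabited in the tree. [cite: Balaban1985BackgroundPropagators, (3.26) p.395, (3.16) p.393] -/
theorem lettersContinuousWithinAt_opsLevelZero {L : ℕ} (ops₀ : ℝ → B8LeafModelZd.ZdIdx d L → ℕ → B9SupplySockB9P3ZdLetters.OpsZd d 𝔸) (M : ℝ)
    (i : B8LeafModelZd.ZdIdx d L) (m : ℕ) (W : Submodule ℝ (Site d → Fin d → 𝔸)) (𝒰 : Set (Site d → Fin d → 𝔸ˣ)) (U₁ : Site d → Fin d → 𝔸ˣ) :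
    LettersContinuousWithinAt i.η (B9Eq327GreenZd.opsLevelZero ops₀ M i m) (i.Ω 0) W 𝒰 U₁ := by
  intro A _ y μ _
  have h : Continuous fun U₀ : Site d → Fin d → 𝔸ˣ => B9SupplySockB9P3ZdLetters.deltaAOf i.η (B9Eq327GreenZd.opsLevelZero ops₀ M i m) U₀ A y μ := by
    simp only [B9Eq327GreenZd.deltaAOf_opsLevelZero]
    exact (continuous_Jcur i.η A μ y).add continuous_const
  exact h.continuousWithinAt

/-- **A6: THE WHOLE HYPOTHESIS SET OF §2 IS MET IN THE TREE** — for the one-level record at a member with finite `Ω₀`, a tracial faithful `τ`, and the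
set `𝒰` of unitary backgrounds: linearity (`linearOnDomAt_opsLevelZero`), continuity (previous theorem) and positivity at `U₁`
(`bondPair_deltaAOf_opsLevelZero_pos`), hence the conclusion of `bondPair_pos_eventually_domSub` (there, of course, positivity holds at every unitary
background outright). [cite: Balaban1985BackgroundPropagators, Thm 3.11 p.416, (3.26) p.395] -/
theorem bondPair_pos_eventually_opsLevelZero [FiniteDimensional ℝ 𝔸] {L : ℕ} (τ : 𝔸 →ₗ[ℂ] ℂ) (hτt : ∀ a b : 𝔸, τ (a * b) = τ (b * a))
    (hτp : ∀ a : 𝔸, a ≠ 0 → 0 < (τ (star a * a)).re)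
    (ops₀ : ℝ → B8LeafModelZd.ZdIdx d L → ℕ → B9SupplySockB9P3ZdLetters.OpsZd d 𝔸) (M : ℝ) (i : B8LeafModelZd.ZdIdx d L) (m : ℕ)
    (hΩ : (i.Ω 0).Finite) {U₁ : Site d → Fin d → 𝔸ˣ} (hU₁ : ∀ (x : Site d) (κ : Fin d), U₁ x κ ∈ B7Prop2Explicit.unitaryUnits 𝔸) :
    ∀ᶠ U₀ in 𝓝[{U | ∀ (x : Site d) (κ : Fin d), U x κ ∈ B7Prop2Explicit.unitaryUnits 𝔸}] U₁,
      ∀ A ∈ B9Eq327GreenZd.domSub (𝔸 := 𝔸) (i.Ω 0), A ≠ 0 →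
        0 < B9Eq327GreenZd.bondPair τ A (B9SupplySockB9P3ZdLetters.deltaAOf i.η (B9Eq327GreenZd.opsLevelZero ops₀ M i m) U₀ A) :=
  bondPair_pos_eventually_domSub τ hΩ hU₁ (fun U₀ _ => B9Eq327GreenZd.linearOnDomAt_opsLevelZero ops₀ M i m U₀)
    (lettersContinuousWithinAt_opsLevelZero ops₀ M i m _ _ U₁)
    fun _ hA hA0 => B9Eq327GreenZd.bondPair_deltaAOf_opsLevelZero_pos ops₀ M i m τ hτt hτp hΩ hU₁ hA hA0

end Current

/-! ## §4  At the cube members: Theorem 3.11's positivity for the genuine four-letter record NEAR THE FLAT BACKGROUND, modulo the continuity of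
its letters (the flat base case is dag-n06-b's `flat_posDef_herm_cube`) -/

/-! ## §5  Reading «for all `U₀ ∈ 𝒰` near `U₁`» in bond variables: finitely many bonds `δ`-close in the fibre norm -/

section Neighbourhood

open B7Prop1Explicit

variable {d : ℕ} {𝔸 : Type*} [CStarAlgebra 𝔸]

/-- a positive lower bound for finitely many positive reals (with `1` for the empty family). [folklore] -/
private theorem exists_pos_le_forall {ι : Type*} (s : Finset ι) {δ : ι → ℝ} (hδ : ∀ i ∈ s, 0 < δ i) : ∃ δ₀ : ℝ, 0 < δ₀ ∧ ∀ i ∈ s, δ₀ ≤ δ i := by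
  classical
  by_cases hs : s.Nonempty
  · refine ⟨s.inf' hs δ, ?_, fun i hi => Finset.inf'_le δ hi⟩
    exact (Finset.lt_inf'_iff hs).2 hδ
  · refine ⟨1, one_pos, fun i hi => ?_⟩
    exact absurd ⟨i, hi⟩ hs

/-- a neighbourhood of a bond variable `u₁` in `𝔸ˣ` contains a norm-ball `{u : ‖u − u₁‖ < δ}` (the unit group of a C⋆-algebra carries the norm topology:
`Units.isOpenEmbedding_val`). [folklore] -/
private theorem exists_ball_subset_of_mem_nhds_units {u₁ : 𝔸ˣ} {t : Set 𝔸ˣ} (ht : t ∈ 𝓝 u₁) :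
    ∃ δ : ℝ, 0 < δ ∧ ∀ u : 𝔸ˣ, ‖(u : 𝔸) - u₁‖ < δ → u ∈ t := by
  rw [Units.isOpenEmbedding_val.nhds_eq_comap, Filter.mem_comap] at ht
  obtain ⟨V, hV, hVt⟩ := ht
  obtain ⟨δ, hδ, hball⟩ := Metric.mem_nhds_iff.1 hV
  refine ⟨δ, hδ, fun u hu => hVt (hball ?_)⟩
  rwa [Metric.mem_ball, dist_eq_norm]

/-- a neighbourhood of `v₁ : {directions} → 𝔸ˣ` contains a uniform norm-ball over the directions. [folklore] -/
private theorem exists_ball_subset_of_mem_nhds_dir {v₁ : Fin d → 𝔸ˣ} {t : Set (Fin d → 𝔸ˣ)} (ht : t ∈ 𝓝 v₁) :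
    ∃ δ : ℝ, 0 < δ ∧ ∀ v : Fin d → 𝔸ˣ, (∀ μ, ‖(v μ : 𝔸) - v₁ μ‖ < δ) → v ∈ t := by
  classical
  rw [nhds_pi, Filter.mem_pi'] at ht
  obtain ⟨J, t', ht', hJt⟩ := ht
  have h : ∀ μ : Fin d, ∃ δ : ℝ, 0 < δ ∧ ∀ u : 𝔸ˣ, ‖(u : 𝔸) - v₁ μ‖ < δ → u ∈ t' μ :=
    fun μ => exists_ball_subset_of_mem_nhds_units (ht' μ)
  choose δ hδ hδt using h
  obtain ⟨δ₀, hδ₀, hle⟩ := exists_pos_le_forall (Finset.univ : Finset (Fin d)) (δ := δ) fun μ _ => hδ μ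
  refine ⟨δ₀, hδ₀, fun v hv => hJt fun μ _ => hδt μ (v μ) (lt_of_lt_of_le (hv μ) (hle μ (Finset.mem_univ μ)))⟩

/-- ★★ **«FOR ALL `U₀ ∈ 𝒰` NEAR `U₁`» MEANS: FINITELY MANY BOND VARIABLES `δ`-CLOSE** — if a property holds for all `U₀ ∈ 𝒰` near `U₁` (product topology on
`ℤᵈ × {directions} → 𝔸ˣ`), then there are a FINITE set `F` of sites and `δ > 0` such that it holds for every `U₀ ∈ 𝒰` with `‖U₀(y, μ) − U₁(y, μ)‖ < δ` for
`y ∈ F` (all directions `μ`); in particular for every `U₀ ∈ 𝒰` that is `δ`-close to `U₁` at EVERY bond (the shape of print's small-field classes).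
[cite: Balaban1985BackgroundPropagators, (3.35) p.396, Thm 3.11 p.416 («for U satisfying (3.35)»)] -/
theorem exists_finset_ball_of_eventually_nhdsWithin {P : (Site d → Fin d → 𝔸ˣ) → Prop} {𝒰 : Set (Site d → Fin d → 𝔸ˣ)}
    {U₁ : Site d → Fin d → 𝔸ˣ} (h : ∀ᶠ U₀ in 𝓝[𝒰] U₁, P U₀) :
    ∃ (F : Finset (Site d)) (δ : ℝ), 0 < δ ∧
      ∀ U₀ ∈ 𝒰, (∀ y ∈ F, ∀ μ : Fin d, ‖(U₀ y μ : 𝔸) - U₁ y μ‖ < δ) → P U₀ := by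
  classical
  rw [eventually_nhdsWithin_iff] at h
  obtain ⟨s, hs, hsP⟩ := h.exists_mem
  rw [nhds_pi, Filter.mem_pi'] at hs
  obtain ⟨I, t, ht, hIt⟩ := hs
  have key : ∀ y : Site d, ∃ δ : ℝ, 0 < δ ∧ ∀ v : Fin d → 𝔸ˣ, (∀ μ, ‖(v μ : 𝔸) - U₁ y μ‖ < δ) → v ∈ t y :=
    fun y => exists_ball_subset_of_mem_nhds_dir (ht y)
  choose δ hδ hδt using key
  obtain ⟨δ₀, hδ₀, hle⟩ := exists_pos_le_forall I (δ := δ) fun y _ => hδ y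
  refine ⟨I, δ₀, hδ₀, fun U₀ hU₀ hclose => hsP U₀ (hIt fun y hy => ?_) hU₀⟩
  exact hδt y (U₀ y) fun μ => lt_of_lt_of_le (hclose y hy μ) (hle y hy)

/-- ★ **THE SUP-NORM READING**: a property holding for all `U₀ ∈ 𝒰` near `U₁` holds for every `U₀ ∈ 𝒰` that is uniformly `δ`-close to `U₁` on all bonds,
for some `δ > 0`. [cite: Balaban1985BackgroundPropagators, (3.35) p.396, Thm 3.11 p.416] -/
theorem exists_delta_of_eventually_nhdsWithin {P : (Site d → Fin d → 𝔸ˣ) → Prop} {𝒰 : Set (Site d → Fin d → 𝔸ˣ)}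
    {U₁ : Site d → Fin d → 𝔸ˣ} (h : ∀ᶠ U₀ in 𝓝[𝒰] U₁, P U₀) :
    ∃ δ : ℝ, 0 < δ ∧ ∀ U₀ ∈ 𝒰, (∀ (y : Site d) (μ : Fin d), ‖(U₀ y μ : 𝔸) - U₁ y μ‖ < δ) → P U₀ := by
  obtain ⟨F, δ, hδ, hP⟩ := exists_finset_ball_of_eventually_nhdsWithin h
  exact ⟨δ, hδ, fun U₀ hU₀ hclose => hP U₀ hU₀ fun y _ μ => hclose y μ⟩

end Neighbourhood

section Cube

open B7Prop1Explicit
open B7Prop2Explicit (unitaryUnits)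
open B8Ineq132 (BondTouches)
open B8LeafModelZd (ZdIdx)
open B8Eq131Cubes (cube sqLo sqHi)
open B8Eq131CubesAdmissible (cubeFam cubeFam_false_zero)
open B8CubeMemberZd (cubeLamS)
open B8Ineq159FlatCubeMemberPrinted (cubeLamBP)
open B9SupplySockB9P3ZdLetters (OpsZd deltaAOf)
open B9SupplySockB9P3ZdAllLettersZd (opsAllZd)
open B9Eq327GreenZd (domSub bondPair LinearOnDomAt)
open B9Eq327GreenZdHerm (domSubH domSubH_le mem_domSubH_iff HermPreservingAt RegularAtH regularAtH_of_bondPair_pos gopZdH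
  gopZdH_apply_eq_of_regularAtH)
open B9Thm311FlatHermKernelZd (flat_posDef_herm_cube)

variable {d : ℕ} {𝔸 : Type*} [CStarAlgebra 𝔸] [FiniteDimensional ℝ 𝔸] [Nontrivial 𝔸] {L : ℕ}

/-- the level-`0` domain of a cube member is the finite box `□₀`. [cite: Balaban1985RegularSpaces, (1.131) p.99] -/
theorem cubeMember_Ω0_finite (i : ZdIdx d L) {a : Site d} {Mc ρ : ℕ} (hΩ : i.Ω = cubeFam false L a Mc ρ i.k) : (i.Ω 0).Finite := by
  rw [hΩ, cubeFam_false_zero]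
  exact B8Eq191FlatLettersCubeMember.inBox_finite (sqLo L a ρ i.k 0) (sqHi L a Mc ρ i.k 0)

variable (τ : 𝔸 →ₗ[ℂ] ℂ) (hτt : ∀ a b : 𝔸, τ (a * b) = τ (b * a)) (hτs : ∀ a : 𝔸, τ (star a) = starRingEnd ℂ (τ a))
  (hτp : ∀ a : 𝔸, a ≠ 0 → 0 < (τ (star a * a)).re)

include hτt hτs hτp in
/-- ★★★ **THEOREM 3.11's POSITIVITY FOR THE GENUINE `Δ_a(U₀)` AT EVERY CUBE MEMBER, ON A NEIGHBOURHOOD OF THE FLAT BACKGROUND — MODULO THE CONTINUITY OF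
THE LETTERS.**  At a cube member `{□_j}` of [Balaban1985RegularSpaces] (1.131) (`Ω = cubeFam false L a Mc ρ k`, `Λs = cubeLamS …`, `d, L ≥ 2`), every
truncation `m ≤ k`, print's class `cubeLamBP` (with the level-`0` crossing bonds), a faithful Hermitian tracial `τ` on a finite-dimensional fibre, and a set
`𝒰 ∋ 1` of backgrounds on which the four-letter `Δ_a(U₀)` (`opsAllZd`) is ℝ-linear on `E(□₀)` and whose letters are continuous in `U₀` within `𝒰` at
`U₀ = 1` on the Hermitian fields: `0 < ⟨A, Δ_a(U₀)A⟩_τ` for every Hermitian `0 ≠ A ∈ E(□₀)` and ALL `U₀ ∈ 𝒰` NEAR `1`.  The base case `U₀ = 1` is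
dag-n06-b's `flat_posDef_herm_cube`; §2 propagates it.  (Print: «Under the assumptions of the Theorems 3.1–3.10 … the operators … Δ_a, G are positive
definite» — here with a member-dependent neighbourhood instead of print's uniform `α₀′`.) [cite: Balaban1985BackgroundPropagators, Thm 3.11 p.416, (3.26) p.395; Balaban1984PropagatorsII, (2.11) p.225; Balaban1985RegularSpaces, (1.131) p.99] -/
theorem bondPair_pos_eventually_one_cube (hd2 : 2 ≤ d) (hL : 2 ≤ L) (ops₀ : ℝ → ZdIdx d L → ℕ → OpsZd d 𝔸) (M : ℝ) (i : ZdIdx d L)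
    {a : Site d} {Mc ρ : ℕ} (hΩ : i.Ω = cubeFam false L a Mc ρ i.k) (hΛs : i.Λs = cubeLamS L a Mc ρ i.k) {m : ℕ} (hm : m ≤ i.k)
    {𝒰 : Set (Site d → Fin d → 𝔸ˣ)} (h1 : (1 : Site d → Fin d → 𝔸ˣ) ∈ 𝒰)
    (hlin : ∀ U₀ ∈ 𝒰, LinearOnDomAt i.η (opsAllZd τ L (cubeLamBP L a Mc ρ i.k) ops₀ M i m) (i.Ω 0) U₀)
    (hcont : LettersContinuousWithinAt i.η (opsAllZd τ L (cubeLamBP L a Mc ρ i.k) ops₀ M i m) (i.Ω 0) (domSubH (i.Ω 0)) 𝒰 1) :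
    ∀ᶠ U₀ in 𝓝[𝒰] (1 : Site d → Fin d → 𝔸ˣ), ∀ A ∈ domSubH (𝔸 := 𝔸) (i.Ω 0), A ≠ 0 →
      0 < bondPair τ A (deltaAOf i.η (opsAllZd τ L (cubeLamBP L a Mc ρ i.k) ops₀ M i m) U₀ A) := by
  refine bondPair_pos_eventually_domSubH τ (cubeMember_Ω0_finite i hΩ) h1 hlin hcont fun A hA hA0 => ?_
  rw [mem_domSubH_iff] at hA
  exact flat_posDef_herm_cube τ hτt hτs hτp hd2 hL ops₀ M i hΩ hΛs hm hA.1 hA.2 hA0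

include hτt hτs hτp in
/-- ★★★ **(3.27) NEAR THE FLAT BACKGROUND: `Δ_a(U₀)↾□₀` IS INVERTIBLE ON `E_𝔤(□₀)` FOR ALL `U₀ ∈ 𝒰` NEAR `1`** (`RegularAtH`, so that `G_𝔤(U₀) = (□₀Δ_a(U₀)□₀)⁻¹`
exists there) — at every cube member as above, given in addition that `Δ_a(U₀)` preserves Hermiticity on `E_𝔤(□₀)` for `U₀ ∈ 𝒰` (dag-n06-b's
`HermPreservingAt`; at `U₀ = 1` it is dag-n06-w2's `isSelfAdjoint_deltaAOf_opsAllZd_one`).  Positivity (previous theorem) ⟹ injective ⟹ bijective on the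
finite-dimensional `E_𝔤(□₀)` (`regularAtH_of_bondPair_pos`). [cite: Balaban1985BackgroundPropagators, Thm 3.11 p.416, (3.27) p.395] -/
theorem regularAtH_eventually_one_cube (hd2 : 2 ≤ d) (hL : 2 ≤ L) (ops₀ : ℝ → ZdIdx d L → ℕ → OpsZd d 𝔸) (M : ℝ) (i : ZdIdx d L)
    {a : Site d} {Mc ρ : ℕ} (hΩ : i.Ω = cubeFam false L a Mc ρ i.k) (hΛs : i.Λs = cubeLamS L a Mc ρ i.k) {m : ℕ} (hm : m ≤ i.k)
    {𝒰 : Set (Site d → Fin d → 𝔸ˣ)} (h1 : (1 : Site d → Fin d → 𝔸ˣ) ∈ 𝒰)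
    (hlin : ∀ U₀ ∈ 𝒰, LinearOnDomAt i.η (opsAllZd τ L (cubeLamBP L a Mc ρ i.k) ops₀ M i m) (i.Ω 0) U₀)
    (hherm : ∀ U₀ ∈ 𝒰, HermPreservingAt i.η (opsAllZd τ L (cubeLamBP L a Mc ρ i.k) ops₀ M i m) (i.Ω 0) U₀)
    (hcont : LettersContinuousWithinAt i.η (opsAllZd τ L (cubeLamBP L a Mc ρ i.k) ops₀ M i m) (i.Ω 0) (domSubH (i.Ω 0)) 𝒰 1) :
    ∀ᶠ U₀ in 𝓝[𝒰] (1 : Site d → Fin d → 𝔸ˣ), RegularAtH i.η (opsAllZd τ L (cubeLamBP L a Mc ρ i.k) ops₀ M i m) (i.Ω 0) U₀ := by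
  filter_upwards [bondPair_pos_eventually_one_cube τ hτt hτs hτp hd2 hL ops₀ M i hΩ hΛs hm h1 hlin hcont, eventually_mem_nhdsWithin]
    with U₀ hpos hU₀
  exact regularAtH_of_bondPair_pos τ (cubeMember_Ω0_finite i hΩ) (hlin U₀ hU₀) (hherm U₀ hU₀) hpos

include hτt hτs hτp in
/-- ★★ **`G_𝔤(U₀)(Δ_a(U₀)A) = A` ON `E_𝔤(□₀)` FOR ALL `U₀ ∈ 𝒰` NEAR THE FLAT BACKGROUND** — (3.27) as [Balaban1985RegularSpaces] (1.58) uses it, for dag-n06-b's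
object `gopZdH` of the genuine record, at every cube member as above. [cite: Balaban1985BackgroundPropagators, (3.27) p.395, Thm 3.11 p.416; Balaban1985RegularSpaces, (1.58) p.86] -/
theorem gopZdH_deltaAOf_eventually_one_cube (hd2 : 2 ≤ d) (hL : 2 ≤ L) (ops₀ : ℝ → ZdIdx d L → ℕ → OpsZd d 𝔸) (M : ℝ) (i : ZdIdx d L)
    {a : Site d} {Mc ρ : ℕ} (hΩ : i.Ω = cubeFam false L a Mc ρ i.k) (hΛs : i.Λs = cubeLamS L a Mc ρ i.k) {m : ℕ} (hm : m ≤ i.k)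
    {𝒰 : Set (Site d → Fin d → 𝔸ˣ)} (h1 : (1 : Site d → Fin d → 𝔸ˣ) ∈ 𝒰)
    (hlin : ∀ U₀ ∈ 𝒰, LinearOnDomAt i.η (opsAllZd τ L (cubeLamBP L a Mc ρ i.k) ops₀ M i m) (i.Ω 0) U₀)
    (hherm : ∀ U₀ ∈ 𝒰, HermPreservingAt i.η (opsAllZd τ L (cubeLamBP L a Mc ρ i.k) ops₀ M i m) (i.Ω 0) U₀)
    (hcont : LettersContinuousWithinAt i.η (opsAllZd τ L (cubeLamBP L a Mc ρ i.k) ops₀ M i m) (i.Ω 0) (domSubH (i.Ω 0)) 𝒰 1) :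
    ∀ᶠ U₀ in 𝓝[𝒰] (1 : Site d → Fin d → 𝔸ˣ), ∀ A ∈ domSubH (𝔸 := 𝔸) (i.Ω 0), ∀ J : Site d → Fin d → 𝔸,
      (∀ (y : Site d) (μ : Fin d), BondTouches (i.Ω 0) y μ → J y μ = deltaAOf i.η (opsAllZd τ L (cubeLamBP L a Mc ρ i.k) ops₀ M i m) U₀ A y μ) →
      gopZdH i.η (opsAllZd τ L (cubeLamBP L a Mc ρ i.k) ops₀ M i m) (i.Ω 0) U₀ J = A := by
  filter_upwards [regularAtH_eventually_one_cube τ hτt hτs hτp hd2 hL ops₀ M i hΩ hΛs hm h1 hlin hherm hcont] with U₀ hreg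
  intro A hA J hJ
  exact gopZdH_apply_eq_of_regularAtH i.η _ (i.Ω 0) U₀ hreg hA hJ

end Cube

end Literature.MathematicalPhysics.QuantumFieldTheory.Balaban1983to89.B9Thm311PosDefOpenZd

end
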